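import Literature.IUT.HodgeArakelov.BadPrimeGaussianMonoidsSyncInftyProofs
import Mathlib.GroupTheory.OrderOfElement
import HarnessLib

/-!
# [IUTchII] Cor 3.5 (ii) / Remark 3.6.1 at the `∞`-level, FAITHFUL FORM: Galois compatibility of the restriction
# of `∞Ψ^ι_env = M^×_TM · ⟨∞θ^ι_env⟩` holds UP TO `Ψ^μ`-TORSION — conjugate synchronization on the roots up to
# roots of unity, discharged from the `Ψ`-level synchronization (proof-only sequel to
# `BadPrimeGaussianMonoidsSyncInftyProofs.lean`, same seat)

S. Mochizuki, *Inter-universal Teichmüller theory II*, kurims Dec-2020 manuscript (paper:url-5036b4059555).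
Prop 1.4 p. 27: "`∞θ(Π)` denotes the subset of elements of the direct limit of cohomology modules … for which
some [positive integer] multiple [i.e., some [positive integer] power, if one writes these modules
«multiplicatively»] coincides, up to torsion, with an element of `θ(Π)`"; Cor 3.5 (ii) p. 95: "`ξ^{ℚ≥0}` denotes
the submonoid generated by the `N`-th roots … of `ξ` [which are uniquely determined, up to multiplication by an
element of the `N`-torsion subgroup of `Ψ^×_cns(M^Θ_*)_{⟨F_l^⋇⟩}`!] that arise by restricting elements of
`∞θ^ι_env(M^Θ_*)`"; third display: "`↞` denotes the compatibility of the action of `G_v(M^Θ_*▶)_{|t|}` on the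
factor labeled `|t|`"; Remark 3.6.1 p. 101: "The «Galois compatibility» … involving the monoids `∞Ψ` [i.e., not
just the monoids `Ψ`!] — corresponds precisely to the «Galois functoriality»" [cite: Mochizuki2012, Cor 3.5 (ii) p.95].
Claim key DISPUTED (D-0012). PROOF-ONLY companion (abc-iut cell, layer L6, seat abc-iut-w5-d131); NO definition,
NO `Prop` fact, no instance.

WHY THIS FILE (self-audit of p416348, STATUS 2026-08-26T02:02Z). `BadPrimeGaussianMonoidsSyncInftyProofs.lean`
proves the DIAGONAL `G_v,⟨F_l^⋇⟩`-stability of the restriction image of `∞Ψ^ι_env` under an EXACT label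
synchronization hypothesis on the roots (`hΘ`, or roots fixed `hfix`).  At a genuine model that exact
hypothesis is not expected to hold: an element `s_t(g)` of the decomposition group `D^δ_{t,μ_-} ≅ G_v` moves an
`N`-th root of the theta class by the Kummer class of a root of unity (print's bracket "up to multiplication by
an element of the `N`-torsion subgroup", p. 95), and two sections differing by an element of `Δ` need not do so
by the SAME root of unity.  What DOES hold, and is proved here from hypotheses of the satisfiable kind only, is:

* `exists_pow_mem_of_mem_splitMonoid_closure` — print's definition of `∞θ` (p. 27: "some positive power
  coincides, up to torsion, with an element of `θ`") propagates from the generators to the whole monoid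
  `M^×_TM · ⟨∞θ^ι_env⟩`: every element has a positive power in the `Ψ`-level monoid `M^×_TM · θ^ℕ`;
* `sync_upToTorsion` — EXACT synchronization on a submonoid `S₀` implies synchronization UP TO `N`-TORSION on every
  `x` with `x^N ∈ S₀`: `conj (s_t g) x = u · conj (s_t' g) x` with `u^N = 1`;
* `pi_conj_eq_mul_piIso_upToTorsion` — hence, for restrictions `r_t` equivariant along the `s_t` (print's "`↞`"),
  the product restriction intertwines `conj ∘ s_{t₀}` with the DIAGONAL action UP TO a family of torsion elements:
  `(r_t (conj (s_{t₀} g) x))_t = (r_t u_t)_t · (β g)_⟨F_l^⋇⟩ (r_t x)_t`, `u_t^N = 1`;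
* `sync_inftyThetaMonoid_upToTorsion_of_kummer_of_fixed`, `pi_restriction_inftyThetaMonoid_upToTorsion_of_kummer_of_fixed`
  — the same at `∞Ψ^ι_env(M^Θ_*)`, with the `Ψ`-level synchronization DISCHARGED from the Kummer data of Prop 3.1
  (ii) (abc-iut-w4-d019 / abc-iut-w5-d086 `sync_units_of_sections`, `sync_splitMonoid`) and the `Ψ`-level `hfix`
  («`s_t(g) ∈ D^δ_{t,μ_-} ⊆ Π_Ÿ` fixes the class `θ`», satisfiable: inner automorphisms of `Π_Ÿ` act trivially on
  classes restricted from `Π_Ÿ`), the printed root condition `hroots` (p. 27) and — for the unit-valuedness of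
  the torsion family — print's «`M^μ_TM ⊆ M^×_TM`» (`htors`, the `hμ` binder of the Cor 1.12 files).

So Remark 3.6.1's Galois compatibility "involving `∞Ψ`" is typed here as: per-label compatibility (`hr`, exact)
plus diagonal compatibility MODULO `Ψ^μ_{⟨F_l^⋇⟩}`; the exact-diagonal theorems of p416348 remain kernel-true
conditionals.  Residual named hypotheses: `hr`, `hfix` (on `θ` only), `hroots`, `htors`. Nothing here asserts a
disputed claim or takes a side on [IUTchIII] Cor 3.12; typed ≠ proved ≠ endorsed.
-/

namespace Literature.IUT.HodgeArakelov

namespace BadPrimeGaussianMonoids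

open TemperedThetaMonoids

universe u v w

/-! ### 1. Synchronization up to torsion: generic bookkeeping -/

section UpToTorsion

variable {H : Type u} [CommGroup H] {P : Type v} [Group P] {G : Type w} [Group G] {T : Type*}
  (conj : P →* MulAut H) (s : T → (G →* P))

/-- **IUTchII:Prop1.4** / **Prop3.1(i)** (kurims p.27, p.87) bookkeeping: print's definition of `∞θ` — "some
[positive integer] power coincides, up to torsion, with an element of `θ`" — propagates from the generators
`Θ = ∞θ^ι_env` (hypothesis `hΘ`, relative to a submonoid `S₀ ⊇ U` absorbing the torsion, e.g. `S₀ = M^×_TM·θ^ℕ`)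
to the whole monoid `U · ⟨Θ⟩`: every element has a positive power in `S₀`.
[cite: Mochizuki2012, Prop 1.4 p.27] -/
theorem exists_pow_mem_of_mem_splitMonoid_closure (U : Subgroup H) (Θ : Set H) (S₀ : Submonoid H)
    (hU : ∀ u ∈ U, u ∈ S₀) (hΘ : ∀ ϑ ∈ Θ, ∃ N : ℕ, 0 < N ∧ ϑ ^ N ∈ S₀) :
    ∀ x ∈ splitMonoid U (Submonoid.closure Θ), ∃ N : ℕ, 0 < N ∧ x ^ N ∈ S₀ := by
  -- the elements with a positive power in `S₀` form a submonoid
  let R : Submonoid H :=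
    { carrier := {x | ∃ N : ℕ, 0 < N ∧ x ^ N ∈ S₀}
      one_mem' := ⟨1, Nat.one_pos, by rw [one_pow]; exact S₀.one_mem⟩
      mul_mem' := by
        rintro x y ⟨N, hN, hx⟩ ⟨M, hM, hy⟩
        refine ⟨N * M, Nat.mul_pos hN hM, ?_⟩
        rw [mul_pow, pow_mul, pow_mul', ← pow_mul' y]
        rw [show y ^ (N * M) = (y ^ M) ^ N by rw [pow_mul']]
        exact S₀.mul_mem (S₀.pow_mem hx M) (S₀.pow_mem hy N) }
  have hle : splitMonoid U (Submonoid.closure Θ) ≤ R := by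
    unfold splitMonoid
    refine sup_le (fun u hu => ⟨1, Nat.one_pos, by rw [pow_one]; exact hU u hu⟩)
      ((Submonoid.closure_le (S := R)).mpr fun ϑ hϑ => hΘ ϑ hϑ)
  exact fun x hx => hle hx

/-- **IUTchII:Cor3.5(ii)** (kurims p.95 l.2–5 "up to multiplication by an element of the `N`-torsion subgroup")
bookkeeping: EXACT synchronization of the actions through two sections on a submonoid `S₀` gives synchronization
UP TO `N`-TORSION on every `x` with `x^N ∈ S₀`. [cite: Mochizuki2012, Cor 3.5 (ii) p.95] -/
theorem sync_upToTorsion (S₀ : Submonoid H) (hsync₀ : ∀ g t t', ∀ x ∈ S₀, conj (s t g) x = conj (s t' g) x)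
    {x : H} {N : ℕ} (hx : x ^ N ∈ S₀) (g : G) (t t' : T) :
    ∃ u : H, u ^ N = 1 ∧ conj (s t g) x = u * conj (s t' g) x := by
  refine ⟨conj (s t g) x * (conj (s t' g) x)⁻¹, ?_, by rw [inv_mul_cancel_right]⟩
  rw [mul_pow, inv_pow, ← map_pow, ← map_pow, hsync₀ g t t' _ hx, mul_inv_cancel]

variable {M : Type*} [CommMonoid M] (β : G →* MulAut M) (r : T → (H →* M))

/-- **IUTchII:Cor3.5(ii)** / **Rmk3.6.1** (kurims p.95, p.101) at the `∞`-level, FAITHFUL FORM: if each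
restriction `r_t` is equivariant along its section `s_t` (print's "`↞`") and the actions are synchronized
EXACTLY on `S₀` (the `Ψ`-level), then on every `x` with `x^N ∈ S₀` the product restriction intertwines the
action through `s_{t₀}` with the DIAGONAL action `G_v,⟨F_l^⋇⟩` UP TO a family of `N`-torsion elements.
[cite: Mochizuki2012, Rmk 3.6.1 p.101] -/
theorem pi_conj_eq_mul_piIso_upToTorsion (hr : ∀ t g x, r t (conj (s t g) x) = β g (r t x))
    (S₀ : Submonoid H) (hsync₀ : ∀ g t t', ∀ x ∈ S₀, conj (s t g) x = conj (s t' g) x)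
    {x : H} {N : ℕ} (hx : x ^ N ∈ S₀) (t₀ : T) (g : G) :
    ∃ u : T → H, (∀ t, u t ^ N = 1) ∧
      MonoidHom.pi r (conj (s t₀ g) x) = (fun t => r t (u t)) * piIso T (β g) (MonoidHom.pi r x) := by
  choose u hu using fun t => sync_upToTorsion conj s S₀ hsync₀ hx g t₀ t
  refine ⟨u, fun t => (hu t).1, funext fun t => ?_⟩
  rw [MonoidHom.pi_apply, (hu t).2, map_mul, hr, Pi.mul_apply]
  rfl

end UpToTorsion

/-! ### 2. At `∞Ψ^ι_env(M^Θ_*) = M^×_TM · ⟨∞θ^ι_env⟩`, from the Kummer data and the `Ψ`-level `hfix` -/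

section InftyTheta

variable {S : ThetaSetting.{u}} (A : AbsTopMonoids S) (Pc : IsoClass S.PiX)
  (E : TemperedThetaMonoids.ThetaEnvData.{u, v} Pc.G) (κ : A.MTM Pc →* E.H)
  {G : Type w} [Group G] {T : Type*}

/-- Every element of `∞Ψ^ι_env(M^Θ_*)` has a positive power in the `Ψ`-level monoid `M^×_TM · θ^ℕ`, given print's
root condition on the generators `∞θ^ι_env` (p. 27, relative to the class `θ`).
[cite: Mochizuki2012, Prop 1.4 p.27] -/
theorem exists_pow_mem_thetaSplit_of_mem_inftyThetaMonoid (ι : E.Iota) (θ : E.H)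
    (hroots : ∀ ϑ ∈ E.inftyThetaEnv ι, ∃ N : ℕ, 0 < N ∧ ϑ ^ N ∈ splitMonoid E.units (Submonoid.powers θ)) :
    ∀ x ∈ E.inftyThetaMonoid ι, ∃ N : ℕ, 0 < N ∧ x ^ N ∈ splitMonoid E.units (Submonoid.powers θ) :=
  exists_pow_mem_of_mem_splitMonoid_closure E.units (E.inftyThetaEnv ι) _
    (fun u hu => (mem_splitMonoid_iff _ _ _).mpr ⟨u, hu, 1, Submonoid.one_mem _, mul_one u⟩) hroots

/-- **IUTchII:Cor3.5(ii)** (kurims p.94–95) conjugate synchronization on `∞Ψ^ι_env(M^Θ_*)` UP TO TORSION: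
sections `s_t : G_v → Π_X(M^Θ_*)` agreeing modulo `Δ` act on each `x ∈ ∞Ψ^ι_env` label-independently up to a
root of unity `u` (`u^N = 1` where `x^N ∈ M^×_TM·θ^ℕ`), the `Ψ`-level synchronization being DISCHARGED from the
Kummer data of Prop 3.1 (ii) and `hfix` («`s_t(g)` fixes the class `θ`»). [cite: Mochizuki2012, Cor 3.5 (ii) p.95] -/
theorem sync_inftyThetaMonoid_upToTorsion_of_kummer_of_fixed (hκ : Function.Injective κ)
    (hcns : E.constantMonoid = MonoidHom.mrange κ)
    (hκeq : ∀ (x : Pc.G) (m : A.MTM Pc), κ (A.actMTM Pc x m) = E.conj x (κ m)) (s : T → (G →* Pc.G))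
    (hs : ∀ t t' g, (QuotientGroup.mk (s t g) : Pc.G ⧸ A.Delta Pc) = QuotientGroup.mk (s t' g))
    (ι : E.Iota) (θ : E.H) (hfix : ∀ g t, E.conj (s t g) θ = θ)
    (hroots : ∀ ϑ ∈ E.inftyThetaEnv ι, ∃ N : ℕ, 0 < N ∧ ϑ ^ N ∈ splitMonoid E.units (Submonoid.powers θ))
    (g : G) (t t' : T) (x : E.H) (hx : x ∈ E.inftyThetaMonoid ι) :
    ∃ (u : E.H) (N : ℕ), 0 < N ∧ u ^ N = 1 ∧ E.conj (s t g) x = u * E.conj (s t' g) x := by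
  obtain ⟨N, hN, hxN⟩ := exists_pow_mem_thetaSplit_of_mem_inftyThetaMonoid Pc E ι θ hroots x hx
  obtain ⟨u, huN, hu⟩ := sync_upToTorsion E.conj s _
    (sync_splitMonoid E.conj s E.units θ (sync_units_of_sections A Pc E κ hκ hcns hκeq s hs)
      (fun g t t' => by rw [hfix, hfix])) hxN g t t'
  exact ⟨u, N, hN, huN, hu⟩

variable {M : Type*} [CommMonoid M]

/-- **IUTchII:Cor3.5(ii)** / **Rmk3.6.1** (kurims p.95, p.101) "the «Galois compatibility» … involving the
monoids `∞Ψ`", FAITHFUL FORM at `∞Ψ^ι_env(M^Θ_*)`: for restrictions `r_t` equivariant along the `s_t` (print's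
"`↞`", the residual named hypothesis `hr`), the product restriction of `x ∈ ∞Ψ^ι_env` intertwines the action
through `s_{t₀}` with the DIAGONAL action `G_v,⟨F_l^⋇⟩` UP TO a family `(r_t u_t)_t` with every `u_t` a TORSION
UNIT of `M^×_TM` (print p.95: "up to multiplication by an element of the `N`-torsion subgroup of
`Ψ^×_cns(M^Θ_*)_{⟨F_l^⋇⟩}`"), given the Kummer data of Prop 3.1 (ii), sections agreeing modulo `Δ`, `hfix` on
`θ`, the root condition of p. 27 and «`M^μ_TM ⊆ M^×_TM`» (`htors`). [cite: Mochizuki2012, Rmk 3.6.1 p.101] -/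
theorem pi_restriction_inftyThetaMonoid_upToTorsion_of_kummer_of_fixed (hκ : Function.Injective κ)
    (hcns : E.constantMonoid = MonoidHom.mrange κ)
    (hκeq : ∀ (x : Pc.G) (m : A.MTM Pc), κ (A.actMTM Pc x m) = E.conj x (κ m)) (s : T → (G →* Pc.G))
    (hs : ∀ t t' g, (QuotientGroup.mk (s t g) : Pc.G ⧸ A.Delta Pc) = QuotientGroup.mk (s t' g))
    (β : G →* MulAut M) (r : T → (E.H →* M)) (hr : ∀ t g x, r t (E.conj (s t g) x) = β g (r t x))
    (ι : E.Iota) (θ : E.H) (hfix : ∀ g t, E.conj (s t g) θ = θ)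
    (hroots : ∀ ϑ ∈ E.inftyThetaEnv ι, ∃ N : ℕ, 0 < N ∧ ϑ ^ N ∈ splitMonoid E.units (Submonoid.powers θ))
    (htors : ∀ u : E.H, IsOfFinOrder u → u ∈ E.units)
    (t₀ : T) (g : G) (x : E.H) (hx : x ∈ E.inftyThetaMonoid ι) :
    ∃ u : T → E.H, (∀ t, u t ∈ E.units ∧ IsOfFinOrder (u t)) ∧
      MonoidHom.pi r (E.conj (s t₀ g) x) = (fun t => r t (u t)) * piIso T (β g) (MonoidHom.pi r x) := by
  obtain ⟨N, hN, hxN⟩ := exists_pow_mem_thetaSplit_of_mem_inftyThetaMonoid Pc E ι θ hroots x hx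
  obtain ⟨u, huN, hu⟩ := pi_conj_eq_mul_piIso_upToTorsion E.conj s β r hr _
    (sync_splitMonoid E.conj s E.units θ (sync_units_of_sections A Pc E κ hκ hcns hκeq s hs)
      (fun g t t' => by rw [hfix, hfix])) hxN t₀ g
  have hfin : ∀ t, IsOfFinOrder (u t) := fun t => isOfFinOrder_iff_pow_eq_one.mpr ⟨N, hN, huN t⟩
  exact ⟨u, fun t => ⟨htors _ (hfin t), hfin t⟩, hu⟩

end InftyTheta

end BadPrimeGaussianMonoids

end Literature.IUT.HodgeArakelov
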